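import Mathlib
import HarnessLib

/-!
# Route `QuarterLogPincer`, crux `TypeIQuantSubcubicExp` (stmt-NavierStokesRegularity-24077), line `smooth_silence` —
# L♯2 plan, part P1d: ENDPOINT facts from `L²` masses on balls

Part P1d of the typed plan `pub-ns-dss/typer/STUB-PLAN-SmoothLimitStep.md` (typer g38; idea-crit-4 SIZE WORD 2026-08-29T08:54Z) for the stub
L♯2 `SmoothSilence.stub_smoothLimitStep` of ns-idea-7's line `smooth_silence` (v1.2).  Three elementary facts about the squared `L²` mass
`∫⁻_{B(x₀,R)} ‖f‖ₑ²` of a field `f : ℝ³ → ℝ³`, used at the two ends of the limit slab: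

* `exists_ne_zero_of_ofReal_le_lintegral_ball` — a positive mass forces a non-zero value in the ball (non-vanishing of the limit at
  time `0`, from `∫_{B(0,Γ₂)} |ωₙ(0)|² ≥ δ`);
* `lintegral_ball_enorm_sq_le_of_norm_le` — a pointwise bound `‖f‖ ≤ m` on the ball bounds the mass by `m² |B(x₀,R)|` (masses of
  equi-bounded fields; `S > 0`);
* `norm_lt_of_lintegral_ball_enorm_sq_lt` — SMALL MASS + LIPSCHITZ ⇒ POINTWISE SMALL: if `f` is `L`-Lipschitz on `B(x₀, R + r)`, `L r ≤ η/2`,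
  and `∫⁻_{B(x₀,R+r)} ‖f‖ₑ² < (η/2)² |B(0,r)|`, then `‖f x‖ < η` on `B(x₀, R)` (vanishing of the limit at the final time, from
  `∫_{B(0,Γ₂+n)} |ωₙ(sₙ)|² → 0` and the uniform gradient bound).

HONEST FRAME: measure-theoretic bookkeeping toward ONE open stub (L♯2); nothing here bears on L♯2's analytic core, E2, the crux, W7 or
Navier–Stokes regularity (OPEN / not proved).  pub-ns-dss typer (g38), `--supports stmt-NavierStokesRegularity-24077`.
-/

noncomputable section

set_option linter.dupNamespace false

namespace Summit.NavierStokesRegularity.NavierStokesRegularity.Cruxes.TypeIQuantSubcubicExp.SmoothSilence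

open MeasureTheory Set Function Filter Topology Metric
open scoped ENNReal NNReal

/-- **Positive mass forces a non-zero value**: if `0 < δ` and `ofReal δ ≤ ∫⁻_{B(x₀,R)} ‖f‖ₑ²` then `f x ≠ 0` for some `x ∈ B(x₀, R)`. -/
theorem exists_ne_zero_of_ofReal_le_lintegral_ball {F : Type*} [NormedAddCommGroup F]
    {f : EuclideanSpace ℝ (Fin 3) → F} {x₀ : EuclideanSpace ℝ (Fin 3)} {R δ : ℝ} (hδ : 0 < δ)
    (h : ENNReal.ofReal δ ≤ ∫⁻ x in ball x₀ R, ‖f x‖ₑ ^ 2) : ∃ x ∈ ball x₀ R, f x ≠ 0 := by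
  by_contra hcon
  push Not at hcon
  have hle : ∫⁻ x in ball x₀ R, ‖f x‖ₑ ^ 2 ≤ ∫⁻ _ in ball x₀ R, (0 : ℝ≥0∞) :=
    setLIntegral_mono' measurableSet_ball fun x hx => by simp [hcon x hx]
  rw [setLIntegral_const, zero_mul] at hle
  have hpos : (0 : ℝ≥0∞) < ENNReal.ofReal δ := ENNReal.ofReal_pos.2 hδ
  exact (lt_irrefl _) (hpos.trans_le (h.trans hle))

/-- **Masses of bounded fields**: `‖f‖ ≤ m` on `B(x₀, R)` gives `∫⁻_{B(x₀,R)} ‖f‖ₑ² ≤ m² |B(x₀,R)|`. -/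
theorem lintegral_ball_enorm_sq_le_of_norm_le {F : Type*} [NormedAddCommGroup F]
    {f : EuclideanSpace ℝ (Fin 3) → F} {x₀ : EuclideanSpace ℝ (Fin 3)} {R m : ℝ}
    (h : ∀ x ∈ ball x₀ R, ‖f x‖ ≤ m) :
    ∫⁻ x in ball x₀ R, ‖f x‖ₑ ^ 2 ≤ ENNReal.ofReal (m ^ 2) * volume (ball x₀ R) := by
  have hle : ∫⁻ x in ball x₀ R, ‖f x‖ₑ ^ 2 ≤ ∫⁻ _ in ball x₀ R, ENNReal.ofReal (m ^ 2) := by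
    refine setLIntegral_mono' measurableSet_ball fun x hx => ?_
    rw [← ofReal_norm, ← ENNReal.ofReal_pow (norm_nonneg _)]
    exact ENNReal.ofReal_le_ofReal (pow_le_pow_left₀ (norm_nonneg _) (h x hx) 2)
  rwa [setLIntegral_const] at hle

/-- **Small mass and a Lipschitz bound force pointwise smallness.**  If `f` is `L`-Lipschitz on `B(x₀, R + r)` (`r > 0`, `L r ≤ η/2`)
and `∫⁻_{B(x₀,R+r)} ‖f‖ₑ² < (η/2)² |B(0,r)|`, then `‖f x‖ < η` for every `x ∈ B(x₀, R)`: otherwise `‖f‖ ≥ η/2` on the whole ball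
`B(x, r) ⊆ B(x₀, R + r)`, whose mass alone is `≥ (η/2)² |B(0,r)|`. -/
theorem norm_lt_of_lintegral_ball_enorm_sq_lt {F : Type*} [NormedAddCommGroup F]
    {f : EuclideanSpace ℝ (Fin 3) → F} {x₀ : EuclideanSpace ℝ (Fin 3)} {R r L η : ℝ} (hr : 0 < r) (hη : 0 < η)
    (hlip : ∀ x ∈ ball x₀ (R + r), ∀ y ∈ ball x₀ (R + r), ‖f x - f y‖ ≤ L * ‖x - y‖) (hL : 0 ≤ L)
    (hLr : L * r ≤ η / 2)
    (hmass : ∫⁻ x in ball x₀ (R + r), ‖f x‖ₑ ^ 2 <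
      ENNReal.ofReal ((η / 2) ^ 2) * volume (ball (0 : EuclideanSpace ℝ (Fin 3)) r)) :
    ∀ x ∈ ball x₀ R, ‖f x‖ < η := by
  intro x hx
  by_contra hcon
  push Not at hcon
  -- the ball `B(x, r)` lies in `B(x₀, R + r)`
  have hsub : ball x r ⊆ ball x₀ (R + r) := by
    intro y hy
    rw [mem_ball] at hx hy ⊢
    calc dist y x₀ ≤ dist y x + dist x x₀ := dist_triangle _ _ _
      _ < r + R := add_lt_add hy hx
      _ = R + r := add_comm _ _
  have hxR : x ∈ ball x₀ (R + r) := hsub (mem_ball_self hr)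
  -- on `B(x, r)` the field stays `≥ η/2`
  have hlow : ∀ y ∈ ball x r, η / 2 ≤ ‖f y‖ := by
    intro y hy
    have hd : ‖f x - f y‖ ≤ L * ‖x - y‖ := hlip x hxR y (hsub hy)
    have hxy : ‖x - y‖ < r := by rw [← dist_eq_norm, dist_comm]; exact hy
    have h1 : ‖f x - f y‖ ≤ η / 2 :=
      hd.trans ((mul_le_mul_of_nonneg_left hxy.le hL).trans hLr)
    have h2 : ‖f x‖ - ‖f y‖ ≤ ‖f x - f y‖ := norm_sub_norm_le _ _
    linarith
  -- hence its mass alone is `≥ (η/2)² |B(0,r)|`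
  have hge : ENNReal.ofReal ((η / 2) ^ 2) * volume (ball (0 : EuclideanSpace ℝ (Fin 3)) r) ≤
      ∫⁻ y in ball x r, ‖f y‖ₑ ^ 2 := by
    have h1 : ∫⁻ _ in ball x r, ENNReal.ofReal ((η / 2) ^ 2) ≤ ∫⁻ y in ball x r, ‖f y‖ₑ ^ 2 := by
      refine setLIntegral_mono' measurableSet_ball fun y hy => ?_
      rw [← ofReal_norm, ← ENNReal.ofReal_pow (norm_nonneg _)]
      exact ENNReal.ofReal_le_ofReal (pow_le_pow_left₀ (by positivity) (hlow y hy) 2)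
    rw [setLIntegral_const, Measure.addHaar_ball_center] at h1
    exact h1
  exact (lt_irrefl _) ((hge.trans (lintegral_mono_set hsub)).trans_lt hmass)

end Summit.NavierStokesRegularity.NavierStokesRegularity.Cruxes.TypeIQuantSubcubicExp.SmoothSilence

end
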